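import Mathlib.RingTheory.MvPolynomial.Basic
import Mathlib.Algebra.MvPolynomial.Degrees
import Mathlib.Analysis.SpecialFunctions.Pow.Real
import Literature.Computability.Complexity.RandomCNF
import HarnessLib

/-!
# Degree-`d` Sum-of-Squares (pseudoexpectations) for CNFs, and the Kothari–Mori–O'Donnell–Witmer
lower bound for random `k`-SAT

Trunk T-CPLX-META (Literature/Computability/MetaComplexity); cite item `wi-03699` (route
PneNP/Feige: the SOS rung of Feige's hypothesis is a THEOREM).

* The arithmetisation of a clause `C` over `0/1`-valued indeterminates `x_v` (`v : ℕ`):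
  `unsatPoly C = ∏_{(v,b) ∈ C} (b ? (1 - x_v) : x_v)`, which vanishes on a Boolean point iff the
  clause is satisfied there (tree convention: the literal `(v, b)` is true iff `σ v = b`).
* Degree-`d` PSEUDOEXPECTATIONS (Kothari–Mori–O'Donnell–Witmer 2017, Defs. 2.7–2.8): a linear
  functional `E` on real polynomials with `E 1 = 1`, `E(p²) ≥ 0` for `deg p ≤ d/2`, SATISFYING an
  identity `q = 0` when `E(q r) = 0` for all `r` with `deg q + deg r ≤ d`. (We let `E` be a linear
  map on all of `MvPolynomial ℕ ℝ`; only its values in degree `≤ d` matter, and any functional on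
  the degree-`≤ d` part extends.)
* `SOSFailsToRefute d φ` ("degree-`d` SOS thinks `φ` is satisfiable", loc. cit. §2.3): there is a
  degree-`d` pseudoexpectation satisfying the Booleanity identities `x_v² - x_v = 0` and the
  constraint identities `unsatPoly C = 0`, `C ∈ φ`. By SDP duality on the hypercube this is the
  non-existence of a degree-`d` SOS/Positivstellensatz refutation; we take KMOW's primal form as
  the definition.
* Named fact `kmow_sos_random_kSAT` (KMOW 2017, Thm. 7.1 = precise Thm. 1.2, for `P = OR_k`,
  whose complexity is `C(OR_k) = k`: `OR_k` supports the `(k-1)`-wise uniform distribution on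
  odd-parity strings and no `k`-wise uniform one): random `k`-SAT with `m = Δn` clauses,
  `Δ ≥ 10`, is, except with probability `≤ β`, NOT refuted by SOS of degree
  `D = β^{a/k} (k 2^b)⁻¹ · n / (Δ^{2/(k-2)} log Δ)` (universal constants `a, b > 0` for the paper's
  `β^{O(1/C(P))} / (k 2^{O(k/C(P))})`). Random model: KMOW's "`m = Δn` constraints uniformly at
  random, scopes of `k` distinct variables, random literal patterns" pushes forward to the tree's
  `randomKCNF k n (Δn)` (order inside a clause is immaterial for `OR`), density `Δ ∈ ℕ`.

## References

* P. K. Kothari, R. Mori, R. O'Donnell, D. Witmer, *Sum of squares lower bounds for refuting any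
  CSP*, STOC 2017, arXiv:1701.04521: Defs. 2.7, 2.8 (pseudoexpectations, identities), §2.3
  (SOS fails to refute = a pseudoexpectation exists), Thm. 1.2 / Thm. 7.1 (weak refutation,
  `D = Ω̃(n/Δ^{2/(C(P)-2)})`), Remark 1.3.
* D. Grigoriev, *Linear lower bound on degrees of Positivstellensatz calculus proofs for the
  parity*, TCS 259 (2001); G. Schoenebeck, *Linear level Lasserre lower bounds for certain k-CSPs*,
  FOCS 2008 (the `k`-XOR case at linear density).
-/

noncomputable section

open Filter Topology MvPolynomial Literature.Computability.Complexity

namespace Literature.Computability.MetaComplexity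

/-! ### Arithmetisation -/

/-- The `0/1`-arithmetisation of a literal's FALSITY: `(v, true) ↦ 1 - x_v`, `(v, false) ↦ x_v`
(the tree's literal `(v, b)` is true iff `x_v = b`). [Kothari–Mori–O'Donnell–Witmer 2017, §2.3
(arithmetisation of constraints)] [folklore] -/
def litFalsePoly (l : Literal ℕ) : MvPolynomial ℕ ℝ :=
  if l.2 then 1 - X l.1 else X l.1

/-- The UNSATISFACTION polynomial of a clause: `∏_{l ∈ C} litFalsePoly l`; on Boolean points it is
`1` iff every literal is false, so "`C` holds" is the identity `unsatPoly C = 0`.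
[Kothari–Mori–O'Donnell–Witmer 2017, §2.3] [folklore] -/
def unsatPoly (C : Clause ℕ) : MvPolynomial ℕ ℝ :=
  (C.map litFalsePoly).prod

/-- The Booleanity axiom `x_v² - x_v = 0`. [Kothari–Mori–O'Donnell–Witmer 2017, §2.3
("`x_i² = x_i`")] [folklore] -/
def boolAxiom (v : ℕ) : MvPolynomial ℕ ℝ :=
  X v ^ 2 - X v

/-! ### Pseudoexpectations -/

/-- **Degree-`d` pseudoexpectation** (as a linear functional on all real polynomials in the
`x_v`, `v : ℕ`): `E 1 = 1` and positive semidefiniteness `E(p²) ≥ 0` for `deg p ≤ d/2`.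
[Kothari–Mori–O'Donnell–Witmer 2017, Def. 2.7] [cite: arXiv170104521, Def. 2.7] -/
def IsPseudoexpectation (d : ℕ) (E : MvPolynomial ℕ ℝ →ₗ[ℝ] ℝ) : Prop :=
  E 1 = 1 ∧ ∀ p : MvPolynomial ℕ ℝ, 2 * p.totalDegree ≤ d → 0 ≤ E (p * p)

/-- `E` **satisfies the identity `q = 0`** in degree `d`: `E(q r) = 0` whenever
`deg q + deg r ≤ d`. [Kothari–Mori–O'Donnell–Witmer 2017, Def. 2.8] [cite: arXiv170104521, Def. 2.8] -/
def SatisfiesIdentity (d : ℕ) (E : MvPolynomial ℕ ℝ →ₗ[ℝ] ℝ) (q : MvPolynomial ℕ ℝ) : Prop :=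
  ∀ r : MvPolynomial ℕ ℝ, q.totalDegree + r.totalDegree ≤ d → E (q * r) = 0

/-- **Degree-`d` SOS fails to (weakly) refute the CNF `φ`** ("thinks `φ` is satisfiable"): some
degree-`d` pseudoexpectation satisfies all Booleanity identities and all clause identities
`unsatPoly C = 0`. [Kothari–Mori–O'Donnell–Witmer 2017, §2.3 (last paragraph), Def. 2.8] [cite: arXiv170104521, §2.3] -/
def SOSFailsToRefute (d : ℕ) (φ : CNF ℕ) : Prop :=
  ∃ E : MvPolynomial ℕ ℝ →ₗ[ℝ] ℝ, IsPseudoexpectation d E ∧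
    (∀ v : ℕ, SatisfiesIdentity d E (boolAxiom v)) ∧ ∀ C ∈ φ, SatisfiesIdentity d E (unsatPoly C)

/-- The KMOW degree bound for `k`-SAT with constants `a, b`:
`D(k, Δ, β, n) = ⌊β^{a/k} · (k · 2^b)⁻¹ · n / (Δ^{2/(k-2)} · log Δ)⌋`.
[Kothari–Mori–O'Donnell–Witmer 2017, Thm. 7.1 (`D = β^{O(1/C)}/(k 2^{O(k/C)}) · n/(Δ^{2/(C-2)} log Δ)`,
`C = C(OR_k) = k`)] [cite: arXiv170104521, Thm. 7.1] -/
def kmowDegree (a b : ℝ) (k Δ : ℕ) (β : ℝ) (n : ℕ) : ℕ :=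
  ⌊β ^ (a / k) / ((k : ℝ) * 2 ^ b) * n / ((Δ : ℝ) ^ ((2 : ℝ) / ((k : ℝ) - 2)) * Real.log Δ)⌋₊

/-! ### The named fact -/

/-- NAMED FACT (**Kothari–Mori–O'Donnell–Witmer 2017, Thm. 7.1 for `k`-SAT**): there are universal
constants `a, b > 0` such that for all `k ≥ 3`, all densities `Δ ≥ 10` (natural, `m = Δn`) and all
`0 < β < 1`, for all sufficiently large `n`,
`Pr_{φ ∼ F_k(n, Δn)}[degree-D SOS fails to refute φ] ≥ 1 - β` with `D = kmowDegree a b k Δ β n`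
(`= β^{a/k}(k2^b)⁻¹ n/(Δ^{2/(k-2)} log Δ)`; at constant `Δ`, `k = 3`: degree `Ω(n)`, i.e. SOS-based
refuters of size `2^{Ω̃(n)}`). ("For all sufficiently large `n`" and the floor are harmless
weakenings of the printed statement.) Users take `(h : kmow_sos_random_kSAT)`.
[Kothari–Mori–O'Donnell–Witmer 2017, Thm. 7.1 (= precise Thm. 1.2), Remark 1.3;
Grigoriev 2001; Schoenebeck 2008] [cite: arXiv170104521, Thm. 7.1] -/
def kmow_sos_random_kSAT : Prop :=
  ∃ a b : ℝ, 0 < a ∧ 0 < b ∧ ∀ (k Δ : ℕ), 3 ≤ k → 10 ≤ Δ → ∀ β : ℝ, 0 < β → β < 1 →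
    ∀ᶠ n : ℕ in atTop,
      1 - ENNReal.ofReal β ≤
        (randomKCNF k n (Δ * n)).toOuterMeasure {φ | SOSFailsToRefute (kmowDegree a b k Δ β n) φ}

/-! ### API -/

/-- On a satisfying Boolean point the unsatisfaction polynomial vanishes; in particular for a
one-literal clause: `unsatPoly [(v, true)] = 1 - x_v`. [folklore] -/
@[simp] theorem unsatPoly_singleton_pos (v : ℕ) : unsatPoly [(v, true)] = 1 - X v := by
  simp [unsatPoly, litFalsePoly]

/-- `unsatPoly [(v, false)] = x_v`. [folklore] -/
@[simp] theorem unsatPoly_singleton_neg (v : ℕ) : unsatPoly [(v, false)] = X v := by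
  simp [unsatPoly, litFalsePoly]

/-- The empty clause arithmetises to `1`, so NO pseudoexpectation satisfies it: SOS of every degree
refutes a CNF containing the empty clause. [Kothari–Mori–O'Donnell–Witmer 2017, §2.3] [folklore] -/
theorem not_sosFailsToRefute_of_nil_mem {d : ℕ} {φ : CNF ℕ} (h : ([] : Clause ℕ) ∈ φ) :
    ¬ SOSFailsToRefute d φ := by
  rintro ⟨E, ⟨h1, -⟩, -, hC⟩
  have := hC [] h 1 (by simp [unsatPoly])
  simp [unsatPoly, h1] at this

/-- A GENUINE expectation is a pseudoexpectation of every degree: evaluation at a Boolean point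
`σ` (as the functional `p ↦ p(σ)`) is a degree-`d` pseudoexpectation satisfying Booleanity, and it
satisfies the clause identities of every clause true at `σ`. Hence SOS never refutes a satisfiable
CNF. [Kothari–Mori–O'Donnell–Witmer 2017, §2.3 ("any probability distribution on solutions
yields a valid degree-`d` pseudoexpectation")] [folklore] -/
theorem sosFailsToRefute_of_forall_eval {d : ℕ} {φ : CNF ℕ} (σ : ℕ → Bool)
    (h : ∀ C ∈ φ, C.eval σ = true) : SOSFailsToRefute d φ := by
  let pt : ℕ → ℝ := fun v => if σ v then 1 else 0
  refine ⟨(MvPolynomial.aeval pt).toLinearMap, ⟨by simp, fun p _ => ?_⟩, fun v r _ => ?_,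
    fun C hC r _ => ?_⟩
  · simp only [AlgHom.toLinearMap_apply, map_mul]; exact mul_self_nonneg _
  · simp only [AlgHom.toLinearMap_apply, map_mul, boolAxiom, map_sub, map_pow, aeval_X]
    have : pt v ^ 2 - pt v = 0 := by simp only [pt]; split <;> norm_num
    rw [this, zero_mul]
  · simp only [AlgHom.toLinearMap_apply, map_mul]
    suffices hz : aeval pt (unsatPoly C) = 0 by rw [hz, zero_mul]
    -- some literal of `C` is true at `σ`; its factor vanishes at `pt`
    have hC' := h C hC
    rw [Clause.eval, List.any_eq_true] at hC'
    obtain ⟨l, hl, hlt⟩ := hC'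
    rw [unsatPoly, map_list_prod, List.prod_eq_zero_iff]
    rw [Literal.eval, beq_iff_eq] at hlt
    have hz : aeval pt (litFalsePoly l) = 0 := by
      unfold litFalsePoly
      cases hb : l.2 <;> simp [pt, hlt, hb]
    rw [← hz]
    exact List.mem_map.2 ⟨_, List.mem_map.2 ⟨l, hl, rfl⟩, rfl⟩

/-- Hence a satisfiable CNF is never SOS-refuted, in any degree. [Kothari–Mori–O'Donnell–Witmer
2017, §2.3] [folklore] -/
theorem sosFailsToRefute_of_satisfiable {d : ℕ} {φ : CNF ℕ} (h : φ.Satisfiable) :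
    SOSFailsToRefute d φ := by
  obtain ⟨σ, hσ⟩ := h
  refine sosFailsToRefute_of_forall_eval σ fun C hC => ?_
  rw [CNF.eval, List.all_eq_true] at hσ
  exact hσ C hC

end Literature.Computability.MetaComplexity
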